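import Summits.QuantumFields.BalabanUV.Beta.GAN24.BiStencilZeroMode
import Summits.QuantumFields.BalabanUV.Beta.GAN24.KernelLegCharges
import Literature.MathematicalPhysics.QuantumFieldTheory.Balaban1983to89.Beta.BalabanStepJetsSucc

/-!
# `BalabanUV.Beta.GAN24.PairingCellTransfer` — binder row G-an2-4 ∕ (CONV-C), row (C) at the levels `j ≥ 1`, CONTACT side; Part 42 of
# `GAN24/FourFaceGaugeSectors`: **KINEMATICS OF THE CONTACT FACE PAIRING** — (i) the cell restriction of a jointly block-covariant pairing moves from one
# slot to the other; (ii) face masks and face-masked leg pairs of bi-localised kernels; (iii) the four-fold absolute summability of a contact word read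
# between two exit faces and the BRIDGE from the nested per-fibre bracket (Parts 37∕38∕40's currency) to the `⟨current, G·current⟩` face pairing of a
# triple word `S κ v ∘ G ∘ S κ′ t` — all generic in a local stencil family `S` and a decaying kernel `G`

NOT IN PRINT; OUR BOOKKEEPING (G-an2-4 crux team (2), leaf prover `b2b-balaban-gan24-formalise-leaf-02`, gen 68).  WHY (memo `CT-THREE-CHANNELS-g68.md` §3c).
Parts 38 ∕ 40 display the CONTACT bracket of road-P2's member zero mode as `PAIRFORM_j = cH²·(⟨J^{cell}_{κα}, G_j J_{κ′β}⟩ + ⟨J_{κ′α}, G_j J^{cell}_{κβ}⟩)` — two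
`⟨current, G_j·current⟩` pairings in which exactly ONE of the two face currents carries the cell restriction of `zmode`'s first slot (`rr ∈ box Lc`).  Road-P2's
pair-form socket (F9 `exists_pairForm_of_word`) needs `R(ab;ce)` antisymmetric in EACH pair; the full face currents are antisymmetric by the Ward identity (leaf-06's
lane), the cell-restricted ones are NOT (the cell face field is not pure gauge) — so each antisymmetry is read on the form in which THAT pair's current is the full one,
and the two forms must agree: the cell restriction has to move between the two currents.  THIS FILE is the generic kinematics ([folklore] lattice-sum bookkeeping;
0 `def`, 0 cited facts, 0 `def … : Prop`, 0 sorry); Part 43 (`ContactPairingCellTransfer`) instantiates it at the typed objects and at Part 40's literal bracket.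
* §1 **`sum_box_tsum_swap_of_cov`** (`G (v+N•t) (s+N•t) = G v s`, summable in each slot ⟹ `Σ_{rr∈box} Σ'_v G v (toSite rr) = Σ_{rr∈box} Σ'_s G (toSite rr) s` — the mechanism
  of my g67 `FourFaceDressedZeroMode.zmode_transpose_of_cov`, abstracted), `sum_box_tsum_swap_of_cov_masked`, **`tsum_mul_transfer_of_cellSum`** (pairing form).
* §2 face masks: `face_coord_add_zsmul`, `faceMask_add_zsmul`, `abs_faceMask_le`, `abs_facePair_term_le`, `summable_facePair`, **`abs_tsum_facePair_le`** (`≤ C·Zl(δ)²` for a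
  `BiLoc` kernel), `tsum_facePair_shiftK`, `ite_eq_mask_mul`, `sum_ite_const_eq_mask_mul`.
* §3 the four-fold machinery: `tsum_four_nested`, `four_shuffle` (generic re-orderings of a summable family on `(X×X)×(X×X)`), `summable_majorant_four` (shear
  equivalence ⟹ product of four exponential series), **`summable_four`**, and the bridge **`nested_eq_facePairing`**:
  `Σ_f Σ'_{(y,z)} 𝟙[y_α]·(S κ v ∘ G)(y,z)(inl α,f)·Σ'_w 𝟙[w_β]·(c·Σ'_t 𝟙[t_κ′]·S κ′ t (z,w)(f,inl β)) = c·Σ'_t 𝟙[t_κ′]·Σ'_{(y,w)} 𝟙[y_α]𝟙[w_β]·(S κ v ∘ G ∘ S κ′ t)(y,w)(inl α, inl β)`.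
HONEST: kinematics only; NO current, pairing or table valued; NOTHING of (C) at j ≥ 1 ∕ `hPair` ∕ `hSrc` ∕ (Q-L) discharged; NEVER «G-an2-4 closed» as (CONV-C); NOT D1,
NOT `BetaPertH`, NOT continuum, NOT Clay.  HONEST DEPENDENCY: continuum YM on T⁴ ⇐ BetaPertH ∧ nine spine estimates (0/9 proved); BetaPertH ⇐ (D1) ∧ (D4) ∧ CAP+tail;
G-an2-4 gates asym, D1 and NE2/3/4.  2026-08-24; no existing file touched.
-/

noncomputable section

open Finset
open scoped BigOperators
open Literature.MathematicalPhysics.QuantumFieldTheory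
open Literature.MathematicalPhysics.QuantumFieldTheory.Balaban1983to89
open Literature.MathematicalPhysics.QuantumFieldTheory.Balaban1983to89.Beta
open B12Sec2to5 (l1 l1_nonneg)
open ExpKernelCalculus (Site MKer Decays BiLoc shiftK comp Zl Zl_pos summable_exp_shift summable_exp_shift' tsum_exp_shift')
open OneStepResolventKernel (Fib LocStencil biLoc_mono)
open AffineAveraging (box toSite)
open BalabanStepJetsSucc (biLoc_comp_right)
open Summit.QuantumFields.BalabanUV.Beta.GAN24.BiStencilZeroMode (tsum_eq_sum_box_tsum)
open Summit.QuantumFields.BalabanUV.Beta.GAN24.KernelLegCharges (tsum_prod_shiftK)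

namespace Summit.QuantumFields.BalabanUV.Beta.GAN24.PairingCellTransfer

variable {d : ℕ} {N : ℕ}
/-! ## §1 Two slots: the cell restriction moves between the slots of a jointly covariant bi-sequence -/

/-- [folklore] **CELL TRANSFER BETWEEN THE TWO SLOTS OF A JOINTLY `N`-COVARIANT BI-SEQUENCE**: if `G (v + N•t) (s + N•t) = G v s` for all `t` and `G` is
summable in each slot separately, then `Σ_{rr ∈ box N} Σ'_v G v (toSite rr) = Σ_{rr ∈ box N} Σ'_s G (toSite rr) s` — which slot is restricted to the
fundamental cell does not matter.  (Cell-decompose the free slot, use covariance to move the block translation onto the restricted slot, re-assemble.) -/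
theorem sum_box_tsum_swap_of_cov [NeZero N] {G : Site (d + 1) → Site (d + 1) → ℝ}
    (hGs : ∀ v, Summable fun s => G v s) (hGv : ∀ s, Summable fun v => G v s)
    (hGcov : ∀ v s t : Site (d + 1), G (v + (N : ℤ) • t) (s + (N : ℤ) • t) = G v s) :
    ∑ rr ∈ box (d + 1) N, ∑' v : Site (d + 1), G v (toSite rr) = ∑ rr ∈ box (d + 1) N, ∑' s : Site (d + 1), G (toSite rr) s := by
  have eL : ∀ rr : Fin (d + 1) → ℕ, ∑' v : Site (d + 1), G v (toSite rr)
      = ∑ r₂ ∈ box (d + 1) N, ∑' t : Site (d + 1), G (toSite r₂) (toSite rr + (N : ℤ) • (-t)) := by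
    intro rr
    rw [tsum_eq_sum_box_tsum (N := N) (hGv (toSite rr))]
    refine Finset.sum_congr rfl fun r₂ _ => tsum_congr fun t => ?_
    have h := hGcov (toSite r₂) (toSite rr + (N : ℤ) • (-t)) t
    rw [add_assoc, smul_neg, neg_add_cancel, add_zero, add_comm] at h
    rw [smul_neg]
    exact h
  have eR : ∀ r₂ : Fin (d + 1) → ℕ, ∑' s : Site (d + 1), G (toSite r₂) s
      = ∑ rr ∈ box (d + 1) N, ∑' t : Site (d + 1), G (toSite r₂) (toSite rr + (N : ℤ) • (-t)) := by
    intro r₂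
    rw [tsum_eq_sum_box_tsum (N := N) (hGs (toSite r₂))]
    refine Finset.sum_congr rfl fun rr _ => ?_
    rw [← (Equiv.neg (Site (d + 1))).tsum_eq (fun t => G (toSite r₂) (toSite rr + (N : ℤ) • (-t)))]
    exact tsum_congr fun t => by simp only [Equiv.neg_apply, neg_neg, add_comm]
  rw [Finset.sum_congr rfl fun rr _ => eL rr, Finset.sum_comm]
  exact Finset.sum_congr rfl fun r₂ _ => (eR r₂).symm

/-- [folklore] The same with BOTH sides read as functions of the restricted slot: for jointly covariant summable `G`, the cell sums of the two marginals agree —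
`Σ_{rr ∈ box} (Σ'_v G v (toSite rr)) = Σ_{rr ∈ box} (Σ'_s G (toSite rr) s)`; stated for a masked bi-sequence `w₁ v · w₂ s · G v s` with `N`-periodic masks
(face indicators), which is again jointly covariant. -/
theorem sum_box_tsum_swap_of_cov_masked [NeZero N] {G : Site (d + 1) → Site (d + 1) → ℝ} {w₁ w₂ : Site (d + 1) → ℝ}
    (hGs : ∀ v, Summable fun s => w₁ v * w₂ s * G v s) (hGv : ∀ s, Summable fun v => w₁ v * w₂ s * G v s)
    (hGcov : ∀ v s t : Site (d + 1), G (v + (N : ℤ) • t) (s + (N : ℤ) • t) = G v s)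
    (hw₁ : ∀ v t : Site (d + 1), w₁ (v + (N : ℤ) • t) = w₁ v) (hw₂ : ∀ s t : Site (d + 1), w₂ (s + (N : ℤ) • t) = w₂ s) :
    ∑ rr ∈ box (d + 1) N, ∑' v : Site (d + 1), w₁ v * w₂ (toSite rr) * G v (toSite rr)
      = ∑ rr ∈ box (d + 1) N, ∑' s : Site (d + 1), w₁ (toSite rr) * w₂ s * G (toSite rr) s :=
  sum_box_tsum_swap_of_cov (G := fun v s => w₁ v * w₂ s * G v s) hGs hGv
    (fun v s t => by rw [hw₁, hw₂, hGcov])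

/-! ## §2 Pairing form: a cell piece against a cell-summed partner -/

/-- [folklore] **CELL TRANSFER INSIDE A PAIRING**: let `Rc`, `Qc` be the cell pieces and `R`, `Q` their block-lattice sums, `R z = Σ'_τ Rc (z + N•τ)`,
`Q z = Σ'_τ Qc (z + N•τ)` (as `HasSum`s), and let the double family `(z, τ) ↦ Rc z · Qc (z + N•τ)` be summable.  Then `Σ'_z Rc z · Q z = Σ'_z R z · Qc z` — the
cell restriction moves from the first factor to the second.  (Fubini over `(z, τ)`, then the translation `z ↦ z − N•τ` in the `z`-series and `τ ↦ −τ`.) -/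
theorem tsum_mul_transfer_of_cellSum {Rc Qc R Q : Site (d + 1) → ℝ}
    (hR : ∀ z, HasSum (fun τ : Site (d + 1) => Rc (z + (N : ℤ) • τ)) (R z))
    (hQ : ∀ z, HasSum (fun τ : Site (d + 1) => Qc (z + (N : ℤ) • τ)) (Q z))
    (hS : Summable fun p : Site (d + 1) × Site (d + 1) => Rc p.1 * Qc (p.1 + (N : ℤ) • p.2)) :
    ∑' z : Site (d + 1), Rc z * Q z = ∑' z : Site (d + 1), R z * Qc z := by
  -- left side as the double sum over (z, τ)
  have hL : ∑' z : Site (d + 1), Rc z * Q z = ∑' p : Site (d + 1) × Site (d + 1), Rc p.1 * Qc (p.1 + (N : ℤ) • p.2) := by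
    rw [hS.tsum_prod]
    refine tsum_congr fun z => ?_
    rw [← (hQ z).tsum_eq, ← tsum_mul_left]
  -- the swapped double family `(z, τ) ↦ Rc (z + N•τ) · Qc z` is the image of the first under the equivalence `(z, τ) ↦ (z + N•τ, −τ)`
  let e : Site (d + 1) × Site (d + 1) ≃ Site (d + 1) × Site (d + 1) :=
    { toFun := fun p => (p.1 + (N : ℤ) • p.2, -p.2)
      invFun := fun p => (p.1 + (N : ℤ) • p.2, -p.2)
      left_inv := fun p => by
        show (p.1 + (N : ℤ) • p.2 + (N : ℤ) • (-p.2), -(-p.2)) = p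
        rw [smul_neg, add_neg_cancel_right, neg_neg]
      right_inv := fun p => by
        show (p.1 + (N : ℤ) • p.2 + (N : ℤ) • (-p.2), -(-p.2)) = p
        rw [smul_neg, add_neg_cancel_right, neg_neg] }
  have hS' : Summable fun p : Site (d + 1) × Site (d + 1) => Rc (p.1 + (N : ℤ) • p.2) * Qc p.1 := by
    have h := (e.summable_iff.2 hS : Summable fun p => Rc (e p).1 * Qc ((e p).1 + (N : ℤ) • (e p).2))
    refine h.congr fun p => ?_
    show Rc (p.1 + (N : ℤ) • p.2) * Qc (p.1 + (N : ℤ) • p.2 + (N : ℤ) • (-p.2)) = Rc (p.1 + (N : ℤ) • p.2) * Qc p.1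
    rw [smul_neg, add_neg_cancel_right]
  have hR' : ∑' z : Site (d + 1), R z * Qc z = ∑' p : Site (d + 1) × Site (d + 1), Rc (p.1 + (N : ℤ) • p.2) * Qc p.1 := by
    rw [hS'.tsum_prod]
    refine tsum_congr fun z => ?_
    rw [← (hR z).tsum_eq, ← tsum_mul_right]
  rw [hL, hR', ← e.tsum_eq (fun p : Site (d + 1) × Site (d + 1) => Rc p.1 * Qc (p.1 + (N : ℤ) • p.2))]
  refine tsum_congr fun p => ?_
  show Rc (p.1 + (N : ℤ) • p.2) * Qc (p.1 + (N : ℤ) • p.2 + (N : ℤ) • (-p.2)) = Rc (p.1 + (N : ℤ) • p.2) * Qc p.1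
  rw [smul_neg, add_neg_cancel_right]


/-! ## §2 Face masks and face-masked leg pairs of bi-localised kernels -/

/-- [folklore] **THE EXIT-FACE CONDITION IS BLOCK-PERIODIC**: the residue of `(y + N•t)_a` mod `N` is that of `y_a`. -/
theorem face_coord_add_zsmul (N : ℕ) (y t : Site (d + 1)) (a : Fin (d + 1)) :
    (y + (N : ℤ) • t) a % (N : ℤ) = y a % (N : ℤ) := by
  simp only [Pi.add_apply, Pi.smul_apply, smul_eq_mul]
  rw [mul_comm, Int.add_mul_emod_self_right]

/-- [folklore] The real face mask is `N`-periodic. -/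
theorem faceMask_add_zsmul (N : ℕ) (y t : Site (d + 1)) (a : Fin (d + 1)) :
    (if (y + (N : ℤ) • t) a % (N : ℤ) = (N : ℤ) - 1 then (1 : ℝ) else 0) = (if y a % (N : ℤ) = (N : ℤ) - 1 then (1 : ℝ) else 0) := by
  rw [face_coord_add_zsmul]

/-- [folklore] The face mask as a real weight is bounded by `1`. -/
theorem abs_faceMask_le (N : ℤ) (y : Site (d + 1)) (a : Fin (d + 1)) :
    |(if y a % N = N - 1 then (1 : ℝ) else 0)| ≤ 1 := by
  split_ifs <;> simp

/-- [folklore] Pointwise majorant of a face-masked entry of a bi-localised kernel. -/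
theorem abs_facePair_term_le {K : MKer (d + 1) (Fib d)} {p q : Site (d + 1)} {C δ : ℝ} (hK : BiLoc K p q C δ)
    (N : ℤ) (α β : Fin (d + 1)) (a b : Fib d) (y w : Site (d + 1)) :
    |(if y α % N = N - 1 then (1 : ℝ) else 0) * (if w β % N = N - 1 then (1 : ℝ) else 0) * K y w a b|
      ≤ C * (Real.exp (-δ * l1 (y - p)) * Real.exp (-δ * l1 (w - q))) := by
  have hk := hK y w a b
  have h0 : 0 ≤ C * Real.exp (-δ * (l1 (y - p) + l1 (w - q))) := (abs_nonneg _).trans hk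
  rw [abs_mul, abs_mul]
  calc |(if y α % N = N - 1 then (1 : ℝ) else 0)| * |(if w β % N = N - 1 then (1 : ℝ) else 0)| * |K y w a b|
      ≤ 1 * 1 * (C * Real.exp (-δ * (l1 (y - p) + l1 (w - q)))) :=
        mul_le_mul (mul_le_mul (abs_faceMask_le N y α) (abs_faceMask_le N w β) (abs_nonneg _) zero_le_one) hk (abs_nonneg _)
          (by norm_num)
    _ = C * (Real.exp (-δ * l1 (y - p)) * Real.exp (-δ * l1 (w - q))) := by rw [one_mul, one_mul, mul_add, Real.exp_add]

/-- [folklore] **A FACE-MASKED LEG PAIR OF A BI-LOCALISED KERNEL IS SUMMABLE** (dominated by the product of the two shifted exponential series). -/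
theorem summable_facePair {K : MKer (d + 1) (Fib d)} {p q : Site (d + 1)} {C δ : ℝ} (hK : BiLoc K p q C δ) (hδ : 0 < δ)
    (N : ℤ) (α β : Fin (d + 1)) (a b : Fib d) :
    Summable fun yw : Site (d + 1) × Site (d + 1) =>
      (if yw.1 α % N = N - 1 then (1 : ℝ) else 0) * (if yw.2 β % N = N - 1 then (1 : ℝ) else 0) * K yw.1 yw.2 a b := by
  have h1 : Summable fun y : Site (d + 1) => Real.exp (-δ * l1 (y - p)) := summable_exp_shift' hδ p
  have h2 : Summable fun w : Site (d + 1) => Real.exp (-δ * l1 (w - q)) := summable_exp_shift' hδ q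
  have hprod : Summable fun yw : Site (d + 1) × Site (d + 1) => Real.exp (-δ * l1 (yw.1 - p)) * Real.exp (-δ * l1 (yw.2 - q)) :=
    h1.mul_of_nonneg h2 (fun _ => (Real.exp_pos _).le) (fun _ => (Real.exp_pos _).le)
  refine Summable.of_norm_bounded (hprod.mul_left C) (fun yw => ?_)
  rw [Real.norm_eq_abs]
  exact abs_facePair_term_le hK N α β a b yw.1 yw.2

/-- [folklore] **… AND ABSOLUTELY BOUNDED** by `C·Zl(δ)²`. -/
theorem abs_tsum_facePair_le {K : MKer (d + 1) (Fib d)} {p q : Site (d + 1)} {C δ : ℝ} (hK : BiLoc K p q C δ) (hδ : 0 < δ)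
    (N : ℤ) (α β : Fin (d + 1)) (a b : Fib d) :
    |∑' yw : Site (d + 1) × Site (d + 1), (if yw.1 α % N = N - 1 then (1 : ℝ) else 0) * (if yw.2 β % N = N - 1 then (1 : ℝ) else 0) *
        K yw.1 yw.2 a b| ≤ C * (Zl (d + 1) δ * Zl (d + 1) δ) := by
  have h1 : Summable fun y : Site (d + 1) => Real.exp (-δ * l1 (y - p)) := summable_exp_shift' hδ p
  have h2 : Summable fun w : Site (d + 1) => Real.exp (-δ * l1 (w - q)) := summable_exp_shift' hδ q
  have hprod : Summable fun yw : Site (d + 1) × Site (d + 1) => Real.exp (-δ * l1 (yw.1 - p)) * Real.exp (-δ * l1 (yw.2 - q)) :=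
    h1.mul_of_nonneg h2 (fun _ => (Real.exp_pos _).le) (fun _ => (Real.exp_pos _).le)
  have hb := tsum_of_norm_bounded (hprod.mul_left C).hasSum (fun yw => by
    rw [Real.norm_eq_abs]; exact abs_facePair_term_le hK N α β a b yw.1 yw.2)
  rw [Real.norm_eq_abs] at hb
  refine hb.trans (le_of_eq ?_)
  have hn1 : Summable fun y : Site (d + 1) => ‖Real.exp (-δ * l1 (y - p))‖ :=
    h1.congr fun y => by rw [Real.norm_eq_abs, abs_of_pos (Real.exp_pos _)]
  have hn2 : Summable fun w : Site (d + 1) => ‖Real.exp (-δ * l1 (w - q))‖ :=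
    h2.congr fun w => by rw [Real.norm_eq_abs, abs_of_pos (Real.exp_pos _)]
  rw [tsum_mul_left, ← tsum_mul_tsum_of_summable_norm hn1 hn2, tsum_exp_shift', tsum_exp_shift']

/-- [folklore] **THE FACE-MASKED LEG PAIR SUM IS INVARIANT UNDER BLOCK TRANSLATION OF THE KERNEL**:
`Σ'_{(y,w)} 𝟙[y_α]𝟙[w_β]·(shiftK (−N•t) K) y w a b = Σ'_{(y,w)} 𝟙[y_α]𝟙[w_β]·K y w a b` (re-index the pair; masks are `N`-periodic; NO summability needed). -/
theorem tsum_facePair_shiftK (N : ℕ) (K : MKer (d + 1) (Fib d)) (t : Site (d + 1)) (α β : Fin (d + 1)) (a b : Fib d) :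
    ∑' yw : Site (d + 1) × Site (d + 1), (if yw.1 α % (N : ℤ) = (N : ℤ) - 1 then (1 : ℝ) else 0) * (if yw.2 β % (N : ℤ) = (N : ℤ) - 1 then (1 : ℝ) else 0) *
        shiftK (-((N : ℤ) • t)) K yw.1 yw.2 a b
      = ∑' yw : Site (d + 1) × Site (d + 1), (if yw.1 α % (N : ℤ) = (N : ℤ) - 1 then (1 : ℝ) else 0) * (if yw.2 β % (N : ℤ) = (N : ℤ) - 1 then (1 : ℝ) else 0) *
        K yw.1 yw.2 a b := by
  have h := tsum_prod_shiftK (fun y w a b => (if y α % (N : ℤ) = (N : ℤ) - 1 then (1 : ℝ) else 0) * (if w β % (N : ℤ) = (N : ℤ) - 1 then (1 : ℝ) else 0) *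
    K y w a b) (-((N : ℤ) • t)) a b
  refine Eq.trans (tsum_congr fun yw => ?_) h
  have e : -((N : ℤ) • t) = (N : ℤ) • (-t) := by rw [smul_neg]
  simp only [shiftK]
  rw [e, faceMask_add_zsmul N yw.1 (-t) α, faceMask_add_zsmul N yw.2 (-t) β]

/-- [folklore] `if P then x else 0 = (if P then 1 else 0) · x`. -/
theorem ite_eq_mask_mul (P : Prop) [Decidable P] (x : ℝ) : (if P then x else 0) = (if P then (1 : ℝ) else 0) * x := by
  split_ifs <;> simp

/-- [folklore] `Σ_f (if P then x_f else 0) = if P then Σ_f x_f else 0` and `(if P then x else 0) = 𝟙[P]·x`, combined. -/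
theorem sum_ite_const_eq_mask_mul {ι : Type*} (T : Finset ι) (P : Prop) [Decidable P] (x : ι → ℝ) :
    ∑ i ∈ T, (if P then x i else 0) = (if P then (1 : ℝ) else 0) * ∑ i ∈ T, x i := by
  split_ifs <;> simp


/-! ## §3 The four-fold machinery and the bridge from the nested per-fibre bracket to the face pairing -/

section Four

variable {S : Fin (d + 1) → Site (d + 1) → MKer (d + 1) (Fib d)} {G : MKer (d + 1) (Fib d)} {Cs CG δ : ℝ}

/-- [folklore] **THE FOUR-FOLD MAJORANT IS SUMMABLE**: `((y,z),(w,t)) ↦ C₁·e^{−(δ/2)|y−v|₁}e^{−(δ/2)|z−v|₁}·(Cs·e^{−δ|z−t|₁}e^{−δ|w−t|₁})` — after the shear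
`(w, t) ↦ (z − t, w − t)` (an equivalence of the index set) it is a product of four shifted exponential series. -/
theorem summable_majorant_four (hδ : 0 < δ) (C₁ Cs' : ℝ) (v : Site (d + 1)) :
    Summable fun q : (Site (d + 1) × Site (d + 1)) × (Site (d + 1) × Site (d + 1)) =>
      (C₁ * (Real.exp (-(δ / 2) * l1 (q.1.1 - v)) * Real.exp (-(δ / 2) * l1 (q.1.2 - v)))) *
        (Cs' * (Real.exp (-δ * l1 (q.1.2 - q.2.2)) * Real.exp (-δ * l1 (q.2.1 - q.2.2)))) := by
  -- the shear equivalence `((y,z),(w,t)) ↦ ((y,z),(z − t, w − t))`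
  let e : (Site (d + 1) × Site (d + 1)) × (Site (d + 1) × Site (d + 1)) ≃ (Site (d + 1) × Site (d + 1)) × (Site (d + 1) × Site (d + 1)) :=
    { toFun := fun q => (q.1, (q.1.2 - q.2.2, q.2.1 - q.2.2))
      invFun := fun q => (q.1, (q.2.2 + (q.1.2 - q.2.1), q.1.2 - q.2.1))
      left_inv := fun q => by
        show (q.1, (q.2.1 - q.2.2 + (q.1.2 - (q.1.2 - q.2.2)), q.1.2 - (q.1.2 - q.2.2))) = q
        rw [sub_sub_cancel, sub_add_cancel]
      right_inv := fun q => by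
        show (q.1, (q.1.2 - (q.1.2 - q.2.1), q.2.2 + (q.1.2 - q.2.1) - (q.1.2 - q.2.1))) = q
        rw [sub_sub_cancel, add_sub_cancel_right] }
  have h2 : Summable fun y : Site (d + 1) => Real.exp (-(δ / 2) * l1 (y - v)) := summable_exp_shift' (by positivity) v
  have h1 : Summable fun a : Site (d + 1) => Real.exp (-δ * l1 a) := by
    have := summable_exp_shift' hδ (0 : Site (d + 1))
    simpa only [sub_zero] using this
  have hyz : Summable fun yz : Site (d + 1) × Site (d + 1) => Real.exp (-(δ / 2) * l1 (yz.1 - v)) * Real.exp (-(δ / 2) * l1 (yz.2 - v)) :=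
    h2.mul_of_nonneg h2 (fun _ => (Real.exp_pos _).le) (fun _ => (Real.exp_pos _).le)
  have hab : Summable fun ab : Site (d + 1) × Site (d + 1) => Real.exp (-δ * l1 ab.1) * Real.exp (-δ * l1 ab.2) :=
    h1.mul_of_nonneg h1 (fun _ => (Real.exp_pos _).le) (fun _ => (Real.exp_pos _).le)
  have hprod : Summable fun q : (Site (d + 1) × Site (d + 1)) × (Site (d + 1) × Site (d + 1)) =>
      (Real.exp (-(δ / 2) * l1 (q.1.1 - v)) * Real.exp (-(δ / 2) * l1 (q.1.2 - v))) * (Real.exp (-δ * l1 q.2.1) * Real.exp (-δ * l1 q.2.2)) :=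
    Summable.mul_of_nonneg
      (f := fun yz : Site (d + 1) × Site (d + 1) => Real.exp (-(δ / 2) * l1 (yz.1 - v)) * Real.exp (-(δ / 2) * l1 (yz.2 - v)))
      (g := fun ab : Site (d + 1) × Site (d + 1) => Real.exp (-δ * l1 ab.1) * Real.exp (-δ * l1 ab.2)) hyz hab
      (fun yz => mul_nonneg (Real.exp_pos _).le (Real.exp_pos _).le) (fun ab => mul_nonneg (Real.exp_pos _).le (Real.exp_pos _).le)
  have ht : Summable fun q : (Site (d + 1) × Site (d + 1)) × (Site (d + 1) × Site (d + 1)) =>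
      (Real.exp (-(δ / 2) * l1 (q.1.1 - v)) * Real.exp (-(δ / 2) * l1 (q.1.2 - v))) *
        (Real.exp (-δ * l1 (q.1.2 - q.2.2)) * Real.exp (-δ * l1 (q.2.1 - q.2.2))) := by
    have h := (e.summable_iff).2 hprod
    exact h.congr fun q => rfl
  exact (ht.mul_left (C₁ * Cs')).congr fun q => by ring

/-- [folklore] **FOUR-FOLD ABSOLUTE SUMMABILITY OF THE CONTACT WORD's FACE READ** (local stencil family `S`, decaying `G`, common rate `δ > 0`; masks `≤ 1`;
first bond `v`, fibre leg `f` fixed): the family `((y,z),(w,t)) ↦ 𝟙[y_α]·(S κ v ∘ G)(y,z)(inl α, f)·(𝟙[w_β]·(𝟙[t_κ′]·S κ′ t (z,w)(f, inl β)))` is summable. -/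
theorem summable_four (hS : LocStencil S Cs δ) (hG : Decays G CG δ) (hδ : 0 < δ) (N : ℤ) (κ κ' α β : Fin (d + 1)) (v : Site (d + 1)) (f : Fib d) :
    Summable fun q : (Site (d + 1) × Site (d + 1)) × (Site (d + 1) × Site (d + 1)) =>
      (if q.1.1 α % N = N - 1 then (1 : ℝ) else 0) * comp (S κ v) G q.1.1 q.1.2 (Sum.inl α) f *
        ((if q.2.1 β % N = N - 1 then (1 : ℝ) else 0) * ((if q.2.2 κ' % N = N - 1 then (1 : ℝ) else 0) * S κ' q.2.2 q.1.2 q.2.1 f (Sum.inl β))) := by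
  obtain ⟨C₁, hA⟩ : ∃ C₁ : ℝ, BiLoc (comp (S κ v) G) v v C₁ (δ / 2) :=
    ⟨_, biLoc_comp_right (hS κ v) hG (by positivity) (by linarith)⟩
  refine Summable.of_norm_bounded (summable_majorant_four hδ C₁ Cs v) (fun q => ?_)
  rw [Real.norm_eq_abs]
  have h1 := hA q.1.1 q.1.2 (Sum.inl α) f
  have h2 := hS κ' q.2.2 q.1.2 q.2.1 f (Sum.inl β)
  have e1 : |(if q.1.1 α % N = N - 1 then (1 : ℝ) else 0)| ≤ 1 := abs_faceMask_le N q.1.1 α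
  have e2 : |(if q.2.1 β % N = N - 1 then (1 : ℝ) else 0)| ≤ 1 := abs_faceMask_le N q.2.1 β
  have e3 : |(if q.2.2 κ' % N = N - 1 then (1 : ℝ) else 0)| ≤ 1 := abs_faceMask_le N q.2.2 κ'
  have h0A : 0 ≤ C₁ * Real.exp (-(δ / 2) * (l1 (q.1.1 - v) + l1 (q.1.2 - v))) := (abs_nonneg _).trans h1
  rw [abs_mul, abs_mul, abs_mul, abs_mul]
  calc |(if q.1.1 α % N = N - 1 then (1 : ℝ) else 0)| * |comp (S κ v) G q.1.1 q.1.2 (Sum.inl α) f| *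
        (|(if q.2.1 β % N = N - 1 then (1 : ℝ) else 0)| * (|(if q.2.2 κ' % N = N - 1 then (1 : ℝ) else 0)| * |S κ' q.2.2 q.1.2 q.2.1 f (Sum.inl β)|))
      ≤ 1 * (C₁ * Real.exp (-(δ / 2) * (l1 (q.1.1 - v) + l1 (q.1.2 - v)))) * (1 * (1 * (Cs * Real.exp (-δ * (l1 (q.1.2 - q.2.2) + l1 (q.2.1 - q.2.2)))))) := by
        refine mul_le_mul (mul_le_mul e1 h1 (abs_nonneg _) zero_le_one) (mul_le_mul e2 (mul_le_mul e3 h2 (abs_nonneg _) zero_le_one) ?_ zero_le_one) ?_ ?_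
        · exact mul_nonneg (abs_nonneg _) (abs_nonneg _)
        · exact mul_nonneg (abs_nonneg _) (mul_nonneg (abs_nonneg _) (abs_nonneg _))
        · exact mul_nonneg zero_le_one h0A
    _ = (C₁ * (Real.exp (-(δ / 2) * l1 (q.1.1 - v)) * Real.exp (-(δ / 2) * l1 (q.1.2 - v)))) *
          (Cs * (Real.exp (-δ * l1 (q.1.2 - q.2.2)) * Real.exp (-δ * l1 (q.2.1 - q.2.2)))) := by
        rw [one_mul, one_mul, one_mul, mul_add, Real.exp_add, mul_add (-δ), Real.exp_add]

/-- [folklore] Generic: a summable family on `(X×X)×(X×X)` summed as `Σ' yz, Σ' w, Σ' t`. -/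
theorem tsum_four_nested {X : Type*} {F : (X × X) × (X × X) → ℝ} (hF : Summable F) :
    ∑' q, F q = ∑' yz : X × X, ∑' w : X, ∑' t : X, F (yz, (w, t)) := by
  rw [hF.tsum_prod]
  exact tsum_congr fun yz => (hF.prod_factor yz).tsum_prod

/-- [folklore] Generic: the same family re-indexed by `(t, ((y, w), z)) ↦ ((y, z), (w, t))` — the iterated sum `Σ' t, Σ' yw, Σ' z` and the
summability of its outer, middle and inner pieces. -/
theorem four_shuffle {X : Type*} {F : (X × X) × (X × X) → ℝ} (hF : Summable F) :
    (∑' q, F q = ∑' t : X, ∑' yw : X × X, ∑' z : X, F ((yw.1, z), (yw.2, t))) ∧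
    (Summable fun t : X => ∑' yw : X × X, ∑' z : X, F ((yw.1, z), (yw.2, t))) ∧
    (∀ t : X, Summable fun yw : X × X => ∑' z : X, F ((yw.1, z), (yw.2, t))) ∧
    (∀ (t : X) (yw : X × X), Summable fun z : X => F ((yw.1, z), (yw.2, t))) := by
  let e : X × ((X × X) × X) ≃ (X × X) × (X × X) :=
    { toFun := fun p => ((p.2.1.1, p.2.2), (p.2.1.2, p.1))
      invFun := fun q => (q.2.2, ((q.1.1, q.2.1), q.1.2))
      left_inv := fun _ => rfl
      right_inv := fun _ => rfl }
  have hF' : Summable fun p : X × ((X × X) × X) => F ((p.2.1.1, p.2.2), (p.2.1.2, p.1)) := e.summable_iff.2 hF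
  have hin : ∀ (t : X) (yw : X × X), Summable fun z : X => F ((yw.1, z), (yw.2, t)) := fun t yw => (hF'.prod_factor t).prod_factor yw
  have hmid : ∀ t : X, Summable fun yw : X × X => ∑' z : X, F ((yw.1, z), (yw.2, t)) := fun t =>
    ((hF'.prod_factor t).hasSum.prod_fiberwise fun yw => (hin t yw).hasSum).summable
  have hmid_eq : ∀ t : X, ∑' p : (X × X) × X, F ((p.1.1, p.2), (p.1.2, t)) = ∑' yw : X × X, ∑' z : X, F ((yw.1, z), (yw.2, t)) :=
    fun t => (hF'.prod_factor t).tsum_prod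
  have hout : Summable fun t : X => ∑' yw : X × X, ∑' z : X, F ((yw.1, z), (yw.2, t)) := by
    have h1 : Summable fun t : X => ∑' p : (X × X) × X, F ((p.1.1, p.2), (p.1.2, t)) :=
      (hF'.hasSum.prod_fiberwise fun t => (hF'.prod_factor t).hasSum).summable
    exact h1.congr fun t => hmid_eq t
  refine ⟨?_, hout, hmid, hin⟩
  have h0 : ∑' p : X × ((X × X) × X), F ((p.2.1.1, p.2.2), (p.2.1.2, p.1)) = ∑' q, F q := e.tsum_eq F
  rw [← h0, hF'.tsum_prod]
  exact tsum_congr fun t => hmid_eq t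

/-- NOT IN PRINT; OUR BOOKKEEPING.  **THE BRIDGE: THE NESTED PER-FIBRE CONTACT BRACKET IS THE FACE PAIRING** (local stencil family `S`, decaying `G`, common rate
`δ > 0`; first bond `v`; any scalar `c` — at the wall `c = cH_j`): summing Part 37 ∕ 40's per-fibre nested word over the fibre leg,
`Σ_f Σ'_{(y,z)} 𝟙[y_α]·(S κ v ∘ G)(y,z)(inl α,f)·Σ'_w 𝟙[w_β]·(c·Σ'_t 𝟙[t_κ′]·S κ′ t (z,w)(f,inl β)) = c·Σ'_t 𝟙[t_κ′]·Σ'_{(y,w)} 𝟙[y_α]𝟙[w_β]·(S κ v ∘ G ∘ S κ′ t)(y,w)(inl α, inl β)`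
(four-fold absolute summability `summable_four`, the two re-orderings `tsum_four_nested` ∕ `four_shuffle`, the finite fibre sum through `Summable.tsum_finsetSum`,
and the definition of `comp`). -/
theorem nested_eq_facePairing (hS : LocStencil S Cs δ) (hG : Decays G CG δ) (hδ : 0 < δ) (N : ℤ) (κ κ' α β : Fin (d + 1)) (v : Site (d + 1)) (c : ℝ) :
    ∑ f : Fib d, ∑' yz : Site (d + 1) × Site (d + 1), (if yz.1 α % N = N - 1 then (1 : ℝ) else 0) * comp (S κ v) G yz.1 yz.2 (Sum.inl α) f *
        ∑' w : Site (d + 1), (if w β % N = N - 1 then (1 : ℝ) else 0) *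
          (c * ∑' t : Site (d + 1), (if t κ' % N = N - 1 then (1 : ℝ) else 0) * S κ' t yz.2 w f (Sum.inl β))
      = c * ∑' t : Site (d + 1), (if t κ' % N = N - 1 then (1 : ℝ) else 0) *
          ∑' yw : Site (d + 1) × Site (d + 1), (if yw.1 α % N = N - 1 then (1 : ℝ) else 0) * (if yw.2 β % N = N - 1 then (1 : ℝ) else 0) *
            comp (comp (S κ v) G) (S κ' t) yw.1 yw.2 (Sum.inl α) (Sum.inl β) := by
  -- the four-fold family, per fibre leg
  have hF := fun f : Fib d => summable_four hS hG hδ N κ κ' α β v f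
  -- step A: each fibre's nested word is `c ·` the full four-fold sum
  have hA : ∀ f : Fib d,
      ∑' yz : Site (d + 1) × Site (d + 1), (if yz.1 α % N = N - 1 then (1 : ℝ) else 0) * comp (S κ v) G yz.1 yz.2 (Sum.inl α) f *
        ∑' w : Site (d + 1), (if w β % N = N - 1 then (1 : ℝ) else 0) *
          (c * ∑' t : Site (d + 1), (if t κ' % N = N - 1 then (1 : ℝ) else 0) * S κ' t yz.2 w f (Sum.inl β))
      = c * ∑' q : (Site (d + 1) × Site (d + 1)) × (Site (d + 1) × Site (d + 1)),
          (if q.1.1 α % N = N - 1 then (1 : ℝ) else 0) * comp (S κ v) G q.1.1 q.1.2 (Sum.inl α) f *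
            ((if q.2.1 β % N = N - 1 then (1 : ℝ) else 0) * ((if q.2.2 κ' % N = N - 1 then (1 : ℝ) else 0) * S κ' q.2.2 q.1.2 q.2.1 f (Sum.inl β))) := by
    intro f
    rw [← tsum_mul_left, tsum_four_nested ((hF f).mul_left c)]
    refine tsum_congr fun yz => ?_
    rw [← tsum_mul_left]
    refine tsum_congr fun w => ?_
    rw [← tsum_mul_left, ← tsum_mul_left, ← tsum_mul_left]
    refine tsum_congr fun t => ?_
    ring
  -- step B/C: re-order each fibre's four-fold sum as `Σ' t, Σ' yw, Σ' z`, then move the finite fibre sum inside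
  have hB := fun f : Fib d => (four_shuffle (hF f)).1
  have hSo := fun f : Fib d => (four_shuffle (hF f)).2.1
  have hSm := fun f : Fib d => (four_shuffle (hF f)).2.2.1
  have hSi := fun f : Fib d => (four_shuffle (hF f)).2.2.2
  simp_rw [hA, hB]
  rw [← Finset.mul_sum, ← Summable.tsum_finsetSum (fun f _ => hSo f)]
  congr 1
  refine tsum_congr fun t => ?_
  rw [← Summable.tsum_finsetSum (fun f _ => hSm f t), ← tsum_mul_left]
  refine tsum_congr fun yw => ?_
  rw [← Summable.tsum_finsetSum (fun f _ => hSi f t yw)]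
  -- step D: the innermost `Σ' z, Σ f` is the composition `(S κ v ∘ G) ∘ S κ′ t` read at `(y, w)`
  unfold ExpKernelCalculus.comp
  rw [← tsum_mul_left, ← tsum_mul_left]
  refine tsum_congr fun z => ?_
  rw [Finset.mul_sum, Finset.mul_sum]
  refine Finset.sum_congr rfl fun f _ => ?_
  ring

end Four

end Summit.QuantumFields.BalabanUV.Beta.GAN24.PairingCellTransfer

end
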